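/-
[OURS · L1 W4.5(b) · EL♮(3)] SPECIMEN-TC⁺ (quartic, one inner step (i)) — the GLOBAL INNER TWO-STEP REGULARITY over the chart at the inner point.
-/
import Summits.ResolutionOfSingularities.ResolutionOfSingularities.Theorems.EquisingularLiftEquisingularLiftNatSpecimenQuarticTcPlusInnerLocalTwoStep
import Summits.ResolutionOfSingularities.ResolutionOfSingularities.Theorems.EquisingularLiftEquisingularLiftNatSpecimenQuarticTcPlusGammaChartF
import Summits.ResolutionOfSingularities.ResolutionOfSingularities.Theorems.EquisingularLiftEquisingularLiftNatSpecimenQuarticTcDeltaTwoStepGlobal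
import HarnessLib

/-!
# [OURS · L1 W4.5(b) · EL♮(3)] SPECIMEN-TC⁺ for the quartic — part IG: GLOBAL INNER TWO-STEP REGULARITY (point of the carrier line, then its strict transform)
# (crux `EquisingularLiftNatThree` = stmt-ResolutionOfSingularities-20148; res-L1-w45b-lead-2 DEALS (D2) 2026-08-27T11:55:26Z «NON-VACUITY
# CERTIFICATES TC⁺»; scoping memo D/res-D-pv-034/SPECIMEN-TCPLUS-SCOPE.md §5; helper, closes nothing)

HONEST FRAMING. OURS (cell `res-hironaka`, chain w45b, slot W4.5(b)); NOT a statement of any manuscript; AI-written, weaker than expert review.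

Setting (the shape `…TcPlusInnerStage` provides after the first point step of the quartic): a locally Noetherian ambient `Y`, a chart
`w : Spec k[X] → Y` (open immersion) with `𝓘_S · 𝒪 = (gL)~` for a closed irreducible `S` (`gL = y₂² + y₁²(1 + y₀⁴)`) and `𝓘_Z · 𝒪 = (y₁, y₂)~`
for a closed `Z ⊆ S` (the carrier line), the closed point `y₁ = w(o) ∈ Z`, the blow-up `β : Y′ → Y` at `y₁` and the blow-up `β′ : Y″ → Y′` along the
ideal sheaf of the reduced strict transform `Z₉ = closure β⁻¹(Z ∖ {y₁})` of the line. We prove (`isRegularLocalRing_innerTwoStep_of_mem_range`)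
that the reduced strict transform `Γ″ = V(closure S″)_red`, `S″ = closure β′⁻¹(closure β⁻¹(S ∖ {y₁}) ∖ Z₉)`, is REGULAR at every point over the
chart. Mechanism = `…TcDeltaTwoStepGlobal.twoStep_core` (1) with the generic `Γ`-chart `gammaChartF` (`f = gL`), the trace of the second centre
computed as the strict transform of `Γι⁻¹ Z` (`image_closure_preimage_diff_eq`), and the local input `…TcPlusInnerLocalTwoStep.isRegular_innerTwoStep`.

References: Stacks 080E, 0804; Hartshorne II 7.13–7.16, Ex. 3.2.6 (via the cited tree files).
-/

set_option linter.dupNamespace false -- mandated namespace `Summit.<Summit>.<Problem>` of this single-conjunct summit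

noncomputable section

open CategoryTheory CategoryTheory.Limits AlgebraicGeometry TopologicalSpace
open MvPolynomial
open AlgebraicGeometry.Scheme.IdealSheafData
open Literature.AlgebraicGeometry.Resolution
open Summit.ResolutionOfSingularities.ResolutionOfSingularities.Theorems.EquisingularLift

namespace Summit.ResolutionOfSingularities.ResolutionOfSingularities.Cruxes.EquisingularLiftNat.Sections

namespace SpecimenQuarticTcPlus

open SpecimenQuarticTcDelta

section InnerTwoStep

variable {k : Type} [Field k]
variable {Y Y' Y'' : Scheme.{0}} [IsLocallyNoetherian Y]
  (w : Spec (CommRingCat.of (MvPolynomial (Fin 3) k)) ⟶ Y) [IsOpenImmersion w]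
  (hc : IsClosed ({w (o k)} : Set Y))
  {S : Set Y} (hSc : IsClosed S) (hSirr : IsIrreducible S)
  (hwS : (vanishingIdeal (⟨S, hSc⟩ : Closeds Y)).comap w =
    ofIdealTop ((Ideal.span {gL k}).map (Scheme.ΓSpecIso (CommRingCat.of (MvPolynomial (Fin 3) k))).inv.hom))
  {Z : Set Y} (hZc : IsClosed Z) (hZS : Z ⊆ S)
  (hwZ : (vanishingIdeal (⟨Z, hZc⟩ : Closeds Y)).comap w =
    ofIdealTop ((Ideal.span (Set.range (WhitneyCubic.cen k))).map (Scheme.ΓSpecIso (CommRingCat.of (MvPolynomial (Fin 3) k))).inv.hom))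
  (hwo : w (o k) ∈ Z) (h2 : IsUnit (2 : k))
  (hS₁ : ¬ S ⊆ {w (o k)})
  {β : Y' ⟶ Y} (hβ : IsBlowup β (vanishingIdeal (⟨{w (o k)}, hc⟩ : Closeds Y)))
  (hS₂ : ¬ closure (β ⁻¹' (S \ {w (o k)})) ⊆ closure (β ⁻¹' (Z \ {w (o k)})))
  {β' : Y'' ⟶ Y'}
  (hβ' : IsBlowup β' (vanishingIdeal (⟨closure (β ⁻¹' (Z \ {w (o k)})), isClosed_closure⟩ : Closeds Y')))

include hSirr hwS hZS hwZ hwo h2 hS₁ hβ hS₂ hβ' in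
/-- **GLOBAL INNER TWO-STEP REGULARITY, core** (strict transforms in the «support» spelling of the tree's strict-transform lemma): `Γ″` is regular
at every point over the chart `w(Spec k[X])`. [OURS · L1 W4.5b · SPECIMEN-TC⁺ (i)] [cite: StacksProject, Tag 080E] -/
theorem innerTwoStep_core :
    ∀ z : (vanishingIdeal (⟨closure (β' ⁻¹' (closure (β ⁻¹' (closure S \
        ((vanishingIdeal (⟨{w (o k)}, hc⟩ : Closeds Y)).support : Set Y))) \
        ((vanishingIdeal (⟨closure (β ⁻¹' (Z \ {w (o k)})), isClosed_closure⟩ : Closeds Y')).support : Set Y'))),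
          isClosed_closure⟩ : Closeds Y'')).subscheme,
      β (β' ((vanishingIdeal (⟨closure (β' ⁻¹' (closure (β ⁻¹' (closure S \
        ((vanishingIdeal (⟨{w (o k)}, hc⟩ : Closeds Y)).support : Set Y))) \
        ((vanishingIdeal (⟨closure (β ⁻¹' (Z \ {w (o k)})), isClosed_closure⟩ : Closeds Y')).support : Set Y'))),
          isClosed_closure⟩ : Closeds Y'')).subschemeι z)) ∈ Set.range w →
      IsRegularLocalRing ((vanishingIdeal (⟨closure (β' ⁻¹' (closure (β ⁻¹' (closure S \
        ((vanishingIdeal (⟨{w (o k)}, hc⟩ : Closeds Y)).support : Set Y))) \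
        ((vanishingIdeal (⟨closure (β ⁻¹' (Z \ {w (o k)})), isClosed_closure⟩ : Closeds Y')).support : Set Y'))),
          isClosed_closure⟩ : Closeds Y'')).subscheme.presheaf.stalk z) := by
  -- ### names
  set y₁ : Y := w (o k) with hy₁
  set C₁ : Y.IdealSheafData := vanishingIdeal (⟨{y₁}, hc⟩ : Closeds Y) with hC₁
  set Z₉ : Set Y' := closure (β ⁻¹' (Z \ {y₁})) with hZ₉
  set C₂ : Y'.IdealSheafData := vanishingIdeal (⟨Z₉, isClosed_closure⟩ : Closeds Y') with hC₂
  set K := vanishingIdeal (⟨closure S, isClosed_closure⟩ : Closeds Y) with hK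
  set S' : Set Y' := closure (β ⁻¹' (closure S \ (C₁.support : Set Y))) with hS'
  set K' := vanishingIdeal (⟨S', isClosed_closure⟩ : Closeds Y') with hK'
  set S'' : Set Y'' := closure (β' ⁻¹' (S' \ (C₂.support : Set Y'))) with hS''
  set K'' := vanishingIdeal (⟨S'', isClosed_closure⟩ : Closeds Y'') with hK''
  have hsupp₁ : (C₁.support : Set Y) = {y₁} := Scheme.IdealSheafData.coe_support_vanishingIdeal _
  have hsupp₂ : (C₂.support : Set Y') = Z₉ := Scheme.IdealSheafData.coe_support_vanishingIdeal _
  have hS'eq : S' = closure (β ⁻¹' (S \ {y₁})) := by rw [hS', hsupp₁, hSc.closure_eq]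
  -- ### ambient facts
  haveI : IsLocallyNoetherian Y' := hβ.isLocallyNoetherian
  haveI : IsLocallyNoetherian Y'' := hβ'.isLocallyNoetherian
  haveI : IsProper β := hβ.isProper
  haveI : IsProper β' := hβ'.isProper
  -- ### the two reduced strict transforms as blow-ups (Stacks 080E)
  have hirr₀ : IsIrreducible (closure S) := hSirr.closure
  have hnot₁ : ¬ closure S ⊆ (C₁.support : Set Y) := by
    rw [hsupp₁, hSc.closure_eq]; exact hS₁
  obtain ⟨ρ₃, hsq₃, -, hρ₃⟩ := Cruxes.EquisingularLift.StrataSplit.exists_isBlowup_reducedStrictTransform Y Y' β C₁ hβ (closure S)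
    isClosed_closure hirr₀ hnot₁
  have hS'irr : IsIrreducible S' := by
    rw [hS'eq]; exact isIrreducible_strictTransform_of_isBlowup ⟨{y₁}, hc⟩ hβ hSirr hS₁
  have hnot₂ : ¬ S' ⊆ (C₂.support : Set Y') := by rw [hsupp₂, hS'eq]; exact hS₂
  obtain ⟨ρ₄, hsq₄, -, hρ₄⟩ := Cruxes.EquisingularLift.StrataSplit.exists_isBlowup_reducedStrictTransform Y' Y'' β' C₂ hβ' S'
    isClosed_closure hS'irr hnot₂
  -- ### the point `x₀` of `Γ` over `y₁` and the chart `φ : Spec DL → Γ`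
  obtain ⟨x₀, hx₀⟩ := exists_point_subscheme_of_mem w (hZS hwo)
  let φ := gammaChartF w hSc (gL k) hwS
  have hφtr := comap_gammaChartF_trace_singleton w hSc hwS (gL_mem_originIdeal k) hc hx₀
  have hφpt : φ (ptL k) = x₀ := gammaChartF_ptF w hSc hwS (gL_mem_originIdeal k) hc hx₀
  let U : (vanishingIdeal (⟨closure S, isClosed_closure⟩ : Closeds Y)).subscheme.Opens := φ.opensRange
  have hrange : Set.range φ = Set.range U.ι := by rw [Scheme.Opens.range_ι]; rfl
  let e := IsOpenImmersion.isoOfRangeEq φ U.ι hrange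
  have he : e.hom ≫ U.ι = φ := IsOpenImmersion.isoOfRangeEq_hom_fac _ _ _
  have hept : (e.hom (ptL k)).1 = x₀ := by
    rw [← hφpt, ← he]; rfl
  -- ### the first restricted blow-up, moved to `Spec DL`: a blow-up at `𝔪₀~`
  have hρ₁' : IsBlowup ((ρ₃ ∣_ U) ≫ e.symm.hom)
      (ofIdealTop ((mbarL k).map (Scheme.ΓSpecIso (CommRingCat.of (DL k))).inv.hom)) := by
    have h := (hρ₃.restrict U).comp_iso e.symm
    rw [← Scheme.IdealSheafData.comap_comp, Iso.symm_inv, he] at h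
    change IsBlowup _ ((C₁.comap _).comap φ) at h
    rw [hφtr] at h
    exact h
  -- ### the second centre: its trace on `Γ′` is the strict transform of `A = Γι⁻¹ Z`
  have hrange' : Set.range (vanishingIdeal (⟨S', isClosed_closure⟩ : Closeds Y')).subschemeι = S' := by
    rw [range_subschemeι, Scheme.IdealSheafData.coe_support_vanishingIdeal]; rfl
  have hinjΓ := (vanishingIdeal (⟨closure S, isClosed_closure⟩ : Closeds Y)).subschemeι.isClosedEmbedding.injective
  set A : Set (vanishingIdeal (⟨closure S, isClosed_closure⟩ : Closeds Y)).subscheme :=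
    (vanishingIdeal (⟨closure S, isClosed_closure⟩ : Closeds Y)).subschemeι ⁻¹' Z with hA
  have himage₀ : (vanishingIdeal (⟨S', isClosed_closure⟩ : Closeds Y')).subschemeι '' (ρ₃ ⁻¹' (A \ {x₀})) = β ⁻¹' (Z \ {y₁}) := by
    apply Set.Subset.antisymm
    · rintro _ ⟨y, hy, rfl⟩
      have hβy : β ((vanishingIdeal (⟨S', isClosed_closure⟩ : Closeds Y')).subschemeι y) =
          (vanishingIdeal (⟨closure S, isClosed_closure⟩ : Closeds Y)).subschemeι (ρ₃ y) := by
        rw [← Scheme.Hom.comp_apply, ← hsq₃, Scheme.Hom.comp_apply]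
      refine ⟨?_, ?_⟩
      · have h1 : β ((vanishingIdeal (⟨S', isClosed_closure⟩ : Closeds Y')).subschemeι y) ∈ Z := by
          rw [hβy]; exact hy.1
        exact h1
      · intro h
        apply hy.2
        change ρ₃ y = x₀
        apply hinjΓ
        rw [hx₀, ← hβy]
        exact h
    · intro y' hy'
      have hy'S : y' ∈ Set.range (vanishingIdeal (⟨S', isClosed_closure⟩ : Closeds Y')).subschemeι := by
        rw [hrange', hS'eq]
        exact subset_closure ⟨hZS hy'.1, hy'.2⟩
      obtain ⟨y, rfl⟩ := hy'S
      have hβy : β ((vanishingIdeal (⟨S', isClosed_closure⟩ : Closeds Y')).subschemeι y) =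
          (vanishingIdeal (⟨closure S, isClosed_closure⟩ : Closeds Y)).subschemeι (ρ₃ y) := by
        rw [← Scheme.Hom.comp_apply, ← hsq₃, Scheme.Hom.comp_apply]
      refine ⟨y, ⟨?_, ?_⟩, rfl⟩
      · change (vanishingIdeal (⟨closure S, isClosed_closure⟩ : Closeds Y)).subschemeι (ρ₃ y) ∈ Z
        rw [← hβy]; exact hy'.1
      · intro h
        apply hy'.2
        change β _ = y₁
        rw [hβy, show ρ₃ y = x₀ from h, hx₀]
  have hclA : IsClosed (closure (ρ₃ ⁻¹' (A \ {x₀}))) := isClosed_closure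
  have himage : (vanishingIdeal (⟨S', isClosed_closure⟩ : Closeds Y')).subschemeι '' (closure (ρ₃ ⁻¹' (A \ {x₀}))) = Z₉ := by
    rw [← (vanishingIdeal (⟨S', isClosed_closure⟩ : Closeds Y')).subschemeι.isClosedEmbedding.closure_image_eq, himage₀]
  have hC₂tr : C₂.comap (vanishingIdeal (⟨S', isClosed_closure⟩ : Closeds Y')).subschemeι =
      vanishingIdeal (⟨closure (ρ₃ ⁻¹' (A \ {x₀})), hclA⟩ : Closeds _) := by
    have h := comap_vanishingIdeal_image_of_isClosedImmersion (vanishingIdeal (⟨S', isClosed_closure⟩ : Closeds Y')).subschemeι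
      ⟨closure (ρ₃ ⁻¹' (A \ {x₀})), hclA⟩
    have hD : (⟨(vanishingIdeal (⟨S', isClosed_closure⟩ : Closeds Y')).subschemeι '' ((⟨closure (ρ₃ ⁻¹' (A \ {x₀})), hclA⟩ : Closeds _) : Set _),
        (vanishingIdeal (⟨S', isClosed_closure⟩ : Closeds Y')).subschemeι.isClosedEmbedding.isClosedMap _
          (⟨closure (ρ₃ ⁻¹' (A \ {x₀})), hclA⟩ : Closeds _).2⟩ : Closeds Y') = ⟨Z₉, isClosed_closure⟩ := Closeds.ext himage
    rw [hD] at h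
    exact h
  -- ### the second restricted blow-up, moved over `Spec DL`: along the reduced strict transform of the carrier line
  have hφA : φ ⁻¹' A = PrimeSpectrum.zeroLocus (cenL k : Set (DL k)) :=
    preimage_gammaChartF_eq_zeroLocus w hSc hwS hZc (Ideal.span (Set.range (WhitneyCubic.cen k))) hwZ
  have hφx₀ : φ ⁻¹' {x₀} = {ptL k} := preimage_gammaChartF_singleton w hSc hwS (gL_mem_originIdeal k) hc hx₀
  have hρ₂' : IsBlowup (ρ₄ ∣_ (ρ₃ ⁻¹ᵁ U))
      (vanishingIdeal (⟨closure (((ρ₃ ∣_ U) ≫ e.symm.hom) ⁻¹' (PrimeSpectrum.zeroLocus (cenL k : Set (DL k)) \ {ptL k})),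
        isClosed_closure⟩ : Closeds _)) := by
    have h := hρ₄.restrict (ρ₃ ⁻¹ᵁ U)
    rw [hC₂tr, comap_vanishingIdeal_of_isOpenImmersion] at h
    have hpre : (Closeds.preimage (⟨closure (ρ₃ ⁻¹' (A \ {x₀})), hclA⟩ : Closeds _) (ρ₃ ⁻¹ᵁ U).ι.continuous) =
        ⟨closure (((ρ₃ ∣_ U) ≫ e.symm.hom) ⁻¹' (PrimeSpectrum.zeroLocus (cenL k : Set (DL k)) \ {ptL k})), isClosed_closure⟩ := by
      apply Closeds.ext
      change (ρ₃ ⁻¹ᵁ U).ι ⁻¹' closure (ρ₃ ⁻¹' (A \ {x₀})) = closure (((ρ₃ ∣_ U) ≫ e.symm.hom) ⁻¹' (PrimeSpectrum.zeroLocus (cenL k : Set (DL k)) \ {ptL k}))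
      rw [(ρ₃ ⁻¹ᵁ U).ι.isOpenEmbedding.isOpenMap.preimage_closure_eq_closure_preimage (Scheme.Hom.continuous _)]
      congr 1
      ext u
      -- `ρ₃ u = φ (ρ₁' u)`
      have hq : φ (((ρ₃ ∣_ U) ≫ e.symm.hom) u) = ρ₃ ((ρ₃ ⁻¹ᵁ U).ι u) := by
        have h1 : ρ₃ ((ρ₃ ⁻¹ᵁ U).ι u) = (U.ι ((ρ₃ ∣_ U) u)) := by
          rw [Scheme.Opens.ι_apply, Scheme.Opens.ι_apply, morphismRestrict_base_coe]
        rw [h1, ← he, Scheme.Hom.comp_apply, Scheme.Hom.comp_apply]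
        change U.ι (e.hom (e.inv ((ρ₃ ∣_ U) u))) = _
        rw [← Scheme.Hom.comp_apply e.inv e.hom, Iso.inv_hom_id]
        rfl
      simp only [Set.mem_preimage, Set.mem_sdiff, Set.mem_singleton_iff]
      rw [← hq]
      constructor
      · rintro ⟨ha, hb⟩
        refine ⟨?_, fun hpt => hb (by rw [hpt, hφpt])⟩
        have : ((ρ₃ ∣_ U) ≫ e.symm.hom) u ∈ φ ⁻¹' A := ha
        rw [hφA] at this
        exact this
      · rintro ⟨ha, hb⟩
        refine ⟨?_, fun hx => hb ?_⟩
        · change ((ρ₃ ∣_ U) ≫ e.symm.hom) u ∈ φ ⁻¹' A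
          rw [hφA]; exact ha
        · have : ((ρ₃ ∣_ U) ≫ e.symm.hom) u ∈ φ ⁻¹' {x₀} := hx
          rw [hφx₀] at this
          exact this
    rw [hpre] at h
    exact h
  -- ### LOCAL INNER TWO-STEP REGULARITY over the chart
  have hreg := isRegular_innerTwoStep k h2 _ hρ₁' _ hρ₂'
  -- ### bookkeeping: where a point of `Γ″` goes
  have hdown : ∀ z : (vanishingIdeal (⟨S'', isClosed_closure⟩ : Closeds Y'')).subscheme,
      (vanishingIdeal (⟨closure S, isClosed_closure⟩ : Closeds Y)).subschemeι (ρ₃ (ρ₄ z)) =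
        β (β' ((vanishingIdeal (⟨S'', isClosed_closure⟩ : Closeds Y'')).subschemeι z)) := by
    intro z
    rw [← Scheme.Hom.comp_apply, hsq₃, Scheme.Hom.comp_apply, ← Scheme.Hom.comp_apply ρ₄, hsq₄, Scheme.Hom.comp_apply]
  intro z hz
  have hzU : ρ₃ (ρ₄ z) ∈ U := by
    change ρ₃ (ρ₄ z) ∈ Set.range φ
    exact mem_range_gammaChartF w hSc (gL k) hwS (by rw [hdown]; exact hz)
  haveI := hreg ⟨z, hzU⟩
  exact IsRegularLocalRing.of_ringEquiv (asIso ((ρ₄ ⁻¹ᵁ (ρ₃ ⁻¹ᵁ U)).ι.stalkMap ⟨z, hzU⟩)).commRingCatIsoToRingEquiv.symm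

omit [IsLocallyNoetherian Y] [IsOpenImmersion w] in
include hSc in
/-- The two spellings of the reduced second strict transform agree. [folklore] -/
theorem closeds_innerTwoStep_eq (β' : Y'' ⟶ Y') :
    (⟨closure (β' ⁻¹' (closure (β ⁻¹' (closure S \ ((vanishingIdeal (⟨{w (o k)}, hc⟩ : Closeds Y)).support : Set Y))) \
        ((vanishingIdeal (⟨closure (β ⁻¹' (Z \ {w (o k)})), isClosed_closure⟩ : Closeds Y')).support : Set Y'))),
          isClosed_closure⟩ : Closeds Y'') =
      ⟨closure (β' ⁻¹' (closure (β ⁻¹' (S \ {w (o k)})) \ closure (β ⁻¹' (Z \ {w (o k)})))), isClosed_closure⟩ := by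
  apply Closeds.ext
  change closure _ = closure _
  rw [Scheme.IdealSheafData.coe_support_vanishingIdeal, Scheme.IdealSheafData.coe_support_vanishingIdeal, hSc.closure_eq]
  rfl

end InnerTwoStep

section InnerTwoStepPublic

variable {k : Type} [Field k]
variable {Y Y' Y'' : Scheme.{0}} [IsLocallyNoetherian Y]
  (w : Spec (CommRingCat.of (MvPolynomial (Fin 3) k)) ⟶ Y) [IsOpenImmersion w]
  {y₁ : Y} (hy₁ : w (o k) = y₁) (hc : IsClosed ({y₁} : Set Y))
  {S : Set Y} (hSc : IsClosed S) (hSirr : IsIrreducible S)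
  (hwS : (vanishingIdeal (⟨S, hSc⟩ : Closeds Y)).comap w =
    ofIdealTop ((Ideal.span {gL k}).map (Scheme.ΓSpecIso (CommRingCat.of (MvPolynomial (Fin 3) k))).inv.hom))
  {Z : Set Y} (hZc : IsClosed Z) (hZS : Z ⊆ S)
  (hwZ : (vanishingIdeal (⟨Z, hZc⟩ : Closeds Y)).comap w =
    ofIdealTop ((Ideal.span (Set.range (WhitneyCubic.cen k))).map (Scheme.ΓSpecIso (CommRingCat.of (MvPolynomial (Fin 3) k))).inv.hom))
  (hwo : y₁ ∈ Z) (h2 : IsUnit (2 : k))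
  (hS₁ : ¬ S ⊆ {y₁})
  {β : Y' ⟶ Y} (hβ : IsBlowup β (vanishingIdeal (⟨{y₁}, hc⟩ : Closeds Y)))
  (hS₂ : ¬ closure (β ⁻¹' (S \ {y₁})) ⊆ closure (β ⁻¹' (Z \ {y₁})))
  {β' : Y'' ⟶ Y'}
  (hβ' : IsBlowup β' (vanishingIdeal (⟨closure (β ⁻¹' (Z \ {y₁})), isClosed_closure⟩ : Closeds Y')))

include hy₁ hSirr hwS hZS hwZ hwo h2 hS₁ hβ hS₂ hβ' in
/-- **GLOBAL INNER TWO-STEP REGULARITY.** After blowing up the point `y₁ = w(o)` of the carrier line `Z ⊆ S` and then the reduced strict transform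
`closure β⁻¹(Z ∖ {y₁})` of the line, the reduced strict transform `V(closure S″)_red` of the surface `S` (`𝓘_S · 𝒪 = (y₂² + y₁²(1 + y₀⁴))~`,
`𝓘_Z · 𝒪 = (y₁, y₂)~` on the chart) is REGULAR at every point over the chart `w(Spec k[X])`. [OURS · L1 W4.5b · SPECIMEN-TC⁺ (i)]
[cite: StacksProject, Tag 080E] -/
theorem isRegularLocalRing_innerTwoStep_of_mem_range
    (z : (vanishingIdeal (⟨closure (β' ⁻¹' (closure (β ⁻¹' (S \ {y₁})) \ closure (β ⁻¹' (Z \ {y₁})))), isClosed_closure⟩ :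
      Closeds Y'')).subscheme)
    (hz : β (β' ((vanishingIdeal (⟨closure (β' ⁻¹' (closure (β ⁻¹' (S \ {y₁})) \ closure (β ⁻¹' (Z \ {y₁})))),
      isClosed_closure⟩ : Closeds Y'')).subschemeι z)) ∈ Set.range w) :
    IsRegularLocalRing ((vanishingIdeal (⟨closure (β' ⁻¹' (closure (β ⁻¹' (S \ {y₁})) \ closure (β ⁻¹' (Z \ {y₁})))),
      isClosed_closure⟩ : Closeds Y'')).subscheme.presheaf.stalk z) := by
  subst hy₁
  have H := innerTwoStep_core w hc hSc hSirr hwS hZc hZS hwZ hwo h2 hS₁ hβ hS₂ hβ'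
  rw [closeds_innerTwoStep_eq w hc hSc β'] at H
  exact H z hz

end InnerTwoStepPublic

end SpecimenQuarticTcPlus

end Summit.ResolutionOfSingularities.ResolutionOfSingularities.Cruxes.EquisingularLiftNat.Sections
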